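/-
Copyright (c) 2026. All rights reserved.
Released under Apache 2.0 license as described in the file LICENSE.
Authors: abc-iut cell, Cor. 3.12 sub-crew seat abc-iut-c312-5 (gen 8).
-/
import Literature.IUT.LogVolume.UnitLogInnerRadiusDeepTie
import HarnessLib

/-!
# The inner radius at a TIE index, VIII: the universal lower bound in WITNESS form — an element outside
# `log_p(𝒪_K^×)` of norm `≤ ‖ϖ‖^{A−1} = p^{−(A−1)/e}` (resp. `≤ ‖ϖ‖^{⌊e/(p−1)⌋−1}`), every odd `p`, every `K`

Proof-only appendix (theorems, no definitions, no named fact) to `UnitLogInnerRadiusDeepTie.lean`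
(`not_closedBall_pred_subset_logUnits_of_level`: `{‖z‖ ≤ ‖ϖ‖^{A−1}} ⊄ log_p(𝒪_K^×)` at every `e = A·(p−1)`;
`not_closedBall_div_pred_subset_logUnits`: `{‖z‖ ≤ ‖ϖ‖^{⌊e/(p−1)⌋−1}} ⊄ log_p(𝒪_K^×)` for every `e`).  The
inhabited-side consumers of the D-0079 R-W cell take the inner-radius LOWER bound as a WITNESS binder
«`∃ z ∉ log_p(𝒪_K^×), ‖z‖ ≤ ρ`» (abc-iut-c312-5's `hmax` shape; abc-iut-W-row-1's socket prints the radius in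
`p`-power form).  This file unbundles the two theorems into exactly that shape:

* `exists_not_mem_logUnits_norm_le_pow_level_pred` — `∃ z ∉ log_p(𝒪_K^×), ‖z‖ ≤ ‖ϖ‖^{A−1}` (`e = A(p−1)`);
* `exists_not_mem_logUnits_norm_le_pow_div_pred` — `∃ z ∉ log_p(𝒪_K^×), ‖z‖ ≤ ‖ϖ‖^{⌊e/(p−1)⌋−1}` (every `e`);
* `norm_unif_pow_eq_rpow` — `‖ϖ‖ⁿ = p^{−n/e}` (bookkeeping over abc-iut-S1's `norm_eq_rpow_of_isUniformizer`);
* `exists_not_mem_logUnits_norm_le_rpow_level_pred` / `…_rpow_div_pred` — the same witnesses with the radius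
  written `p^{−((A−1)/e)}`, resp. `p^{−((⌊e/(p−1)⌋−1)/e)}`;
* `exists_not_mem_logUnits_norm_le_pow_of_le` — monotonicity of the consumer's slot: a witness at radius
  `‖ϖ‖^{R−1}` is one at every radius `‖ϖ‖^{R'−1}`, `R' ≤ R` (so `R₀ := ⌊e/(p−1)⌋` may replace any smaller `R₀`);
* `unif_pow_level_succ_mul_mem_logUnits_and_exists` — the unconditional `hc`/`hmax`-style PAIR at a tie:
  `ϖ^{A+1}·𝒪 ⊆ log_p(𝒪_K^×)` and a non-logarithm of norm `≤ ‖ϖ‖^{A−1}`;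
* v2 (append-only): `exists_not_mem_logUnits_norm_le_rpow_of_le`, `…_rpow_div_intSlot`, `…_rpow_level_intSlot` —
  the same witnesses in the INTEGER slot shape `‖z‖ ≤ p^{−((ρ : ℝ) − 1)/e}` (`ρ : ℤ`) of abc-iut-W-row-1's
  `licence_settingPrVolSharp_of_orders_of_realises` (`ρin := e/(p−1)` at a tie, `⌊e/(p−1)⌋` anywhere).

References: [cite: NeukirchANT1999, Ch. II Prop. (5.5)–(5.7)] [cite: Washington1997, Lemma 1.4, §5.1].  Classical;
`logUnits` is the cell's typing of [IUTchIV] Prop. 1.2's `log_p(R^×)` ([claim: Mochizuki2012, status: disputed]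
for that locution only).  Consumer (record only): D-0079 R-W W1 composers (rows 1–4 of `OPEN-10.md` at the wild
places `p ∈ {3, 5}`).  Nothing here is disputed mathematics; no IUT statement is asserted; nothing bears on
[IUTchIII] Cor. 3.12.
-/

noncomputable section

open Metric Set
open scoped NormedField

namespace Literature.IUT.LogVolume

namespace LogEnvelope

open RamificationCriterion BoundaryRamification Literature.NumberTheory.GaloisRepresentations.Ultrametric

section Level

variable (p : ℕ) [hp : Fact p.Prime]
variable {K : Type*} [NontriviallyNormedField K] [instK : NormedAlgebra ℚ_[p] K] [IsUltrametricDist K]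
  [ProperSpace K]
variable {ϖ : Kˣ} (hϖ : IsUniformizer ϖ) {A : ℕ} (hA : absRamificationIdx p K = A * (p - 1))
include hϖ hA

/-- **Witness form at a tie**: at `e = A·(p−1)` (`p` odd, any `A`, any `K`) some `z ∉ log_p(𝒪_K^×)` has
`‖z‖ ≤ ‖ϖ‖^{A−1}` — the inner radius of the log-unit lattice is `≥ A`. [cite: NeukirchANT1999, Ch. II (5.5)–(5.7)] -/
theorem exists_not_mem_logUnits_norm_le_pow_level_pred (hp2 : p ≠ 2) :
    ∃ z : K, z ∉ logUnits K ∧ ‖z‖ ≤ ‖(ϖ : K)‖ ^ (A - 1) := by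
  obtain ⟨z, hz, hzΛ⟩ := Set.not_subset.mp (not_closedBall_pred_subset_logUnits_of_level p hϖ hA hp2)
  exact ⟨z, hzΛ, mem_closedBall_zero_iff.mp hz⟩

end Level

section Uniform

variable (p : ℕ) [hp : Fact p.Prime]
variable {K : Type*} [NontriviallyNormedField K] [instK : NormedAlgebra ℚ_[p] K] [IsUltrametricDist K]
  [ProperSpace K]
variable {ϖ : Kˣ} (hϖ : IsUniformizer ϖ)
include hϖ

/-- **Witness form, every `e`**: for every odd `p` and every `K` some `z ∉ log_p(𝒪_K^×)` has
`‖z‖ ≤ ‖ϖ‖^{⌊e/(p−1)⌋−1}` — the inner radius is `≥ ⌊e/(p−1)⌋`. [cite: NeukirchANT1999, Ch. II (5.5)–(5.7)] -/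
theorem exists_not_mem_logUnits_norm_le_pow_div_pred (hp2 : p ≠ 2) :
    ∃ z : K, z ∉ logUnits K ∧ ‖z‖ ≤ ‖(ϖ : K)‖ ^ (absRamificationIdx p K / (p - 1) - 1) := by
  obtain ⟨z, hz, hzΛ⟩ := Set.not_subset.mp (not_closedBall_div_pred_subset_logUnits p hϖ hp2)
  exact ⟨z, hzΛ, mem_closedBall_zero_iff.mp hz⟩

/-- Bookkeeping: `‖ϖ‖ⁿ = p^{−n/e}`. [cite: NeukirchANT1999, Ch. II (5.5)] -/
theorem norm_unif_pow_eq_rpow (n : ℕ) :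
    ‖(ϖ : K)‖ ^ n = (p : ℝ) ^ (-((n : ℝ) / (absRamificationIdx p K : ℝ))) := by
  have hp0 : (0 : ℝ) ≤ p := by positivity
  rw [← Real.rpow_natCast, norm_eq_rpow_of_isUniformizer p K hϖ, ← Real.rpow_mul hp0]
  congr 1
  ring

omit [IsUltrametricDist K] [ProperSpace K] in
/-- **Monotonicity of the witness slot**: a non-logarithm of norm `≤ ‖ϖ‖^{R−1}` is one of norm `≤ ‖ϖ‖^{R'−1}`
for every `R' ≤ R` (so a certified bound may replace any weaker one the consumer asks for).
[cite: NeukirchANT1999, Ch. II (5.5)] -/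
theorem exists_not_mem_logUnits_norm_le_pow_of_le {R R' : ℕ} (hR : R' ≤ R)
    (h : ∃ z : K, z ∉ logUnits K ∧ ‖z‖ ≤ ‖(ϖ : K)‖ ^ (R - 1)) :
    ∃ z : K, z ∉ logUnits K ∧ ‖z‖ ≤ ‖(ϖ : K)‖ ^ (R' - 1) := by
  obtain ⟨z, hzΛ, hz⟩ := h
  exact ⟨z, hzΛ, hz.trans (pow_le_pow_of_le_one (norm_nonneg _) hϖ.1.le (by omega))⟩

/-- **Witness form, every `e`, `p`-power radius**: some `z ∉ log_p(𝒪_K^×)` has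
`‖z‖ ≤ p^{−(⌊e/(p−1)⌋ − 1)/e}` (natural-number subtraction inside). [cite: NeukirchANT1999, Ch. II (5.5)–(5.7)] -/
theorem exists_not_mem_logUnits_norm_le_rpow_div_pred (hp2 : p ≠ 2) :
    ∃ z : K, z ∉ logUnits K ∧
      ‖z‖ ≤ (p : ℝ) ^ (-(((absRamificationIdx p K / (p - 1) - 1 : ℕ) : ℝ) / (absRamificationIdx p K : ℝ))) := by
  obtain ⟨z, hzΛ, hz⟩ := exists_not_mem_logUnits_norm_le_pow_div_pred p hϖ hp2
  exact ⟨z, hzΛ, by rwa [← norm_unif_pow_eq_rpow p hϖ]⟩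

end Uniform

section LevelRpow

variable (p : ℕ) [hp : Fact p.Prime]
variable {K : Type*} [NontriviallyNormedField K] [instK : NormedAlgebra ℚ_[p] K] [IsUltrametricDist K]
  [ProperSpace K]
variable {ϖ : Kˣ} (hϖ : IsUniformizer ϖ) {A : ℕ} (hA : absRamificationIdx p K = A * (p - 1))
include hϖ hA

/-- **Witness form at a tie, `p`-power radius**: at `e = A·(p−1)` some `z ∉ log_p(𝒪_K^×)` has
`‖z‖ ≤ p^{−(A−1)/e}` (natural-number subtraction `A − 1`, harmless as `A ≥ 1`).
[cite: NeukirchANT1999, Ch. II (5.5)–(5.7)] -/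
theorem exists_not_mem_logUnits_norm_le_rpow_level_pred (hp2 : p ≠ 2) :
    ∃ z : K, z ∉ logUnits K ∧
      ‖z‖ ≤ (p : ℝ) ^ (-(((A - 1 : ℕ) : ℝ) / (absRamificationIdx p K : ℝ))) := by
  obtain ⟨z, hzΛ, hz⟩ := exists_not_mem_logUnits_norm_le_pow_level_pred p hϖ hA hp2
  exact ⟨z, hzΛ, by rwa [← norm_unif_pow_eq_rpow p hϖ]⟩

/-- **The critical inner ball in witness-pair form** (abc-iut-c312-5's `hc`/`hmax` binders with `c := ϖ^{A+1}`
when only the universal bracket is known): `ϖ^{A+1}·𝒪 ⊆ log_p(𝒪_K^×)` — i.e. `‖o‖ ≤ 1 ⇒ ϖ^{A+1}·o ∈ Λ` — and a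
non-logarithm `w` with `‖w‖·‖ϖ‖ ≤ ‖ϖ^{A+1}‖·‖ϖ‖⁻¹`, namely `‖w‖ ≤ ‖ϖ‖^{A−1}`, two levels below.  (The EXACT
`hmax` needs the torsion-witness bit; this pair is what is available unconditionally.)
[cite: NeukirchANT1999, Ch. II (5.5)–(5.7)] -/
theorem unif_pow_level_succ_mul_mem_logUnits_and_exists (hp2 : p ≠ 2) :
    (∀ o : K, ‖o‖ ≤ 1 → (ϖ : K) ^ (A + 1) * o ∈ logUnits K) ∧
      ∃ w : K, w ∉ logUnits K ∧ ‖w‖ ≤ ‖(ϖ : K)‖ ^ (A - 1) := by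
  refine ⟨fun o ho => ?_, exists_not_mem_logUnits_norm_le_pow_level_pred p hϖ hA hp2⟩
  refine (innerRadius_tie_bracket p hϖ hA hp2).1 ?_
  rw [mem_closedBall_zero_iff, norm_mul, norm_pow]
  exact mul_le_of_le_one_right (pow_nonneg (norm_nonneg _) _) ho

end LevelRpow

/-! ### v2 (append-only): the witnesses in the INTEGER-parameter slot shape of the W1 composers
(`‖z‖ ≤ p^{−((ρ : ℝ) − 1)/e}` with `ρ : ℤ`, as in abc-iut-W-row-1's `licence_settingPrVolSharp_of_orders_of_realises`) -/

section IntSlot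

variable (p : ℕ) [hp : Fact p.Prime]
variable {K : Type*} [NontriviallyNormedField K] [instK : NormedAlgebra ℚ_[p] K] [IsUltrametricDist K]
  [ProperSpace K]
variable {ϖ : Kˣ} (hϖ : IsUniformizer ϖ)
include hϖ

omit instK [IsUltrametricDist K] [ProperSpace K] hϖ in
/-- Slot monotonicity in `p`-power form: a non-logarithm of norm `≤ p^{−x}` is one of norm `≤ p^{−y}` for
every `y ≤ x`. [cite: NeukirchANT1999, Ch. II (5.5)] -/
theorem exists_not_mem_logUnits_norm_le_rpow_of_le {x y : ℝ} (hxy : y ≤ x)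
    (h : ∃ z : K, z ∉ logUnits K ∧ ‖z‖ ≤ (p : ℝ) ^ (-x)) :
    ∃ z : K, z ∉ logUnits K ∧ ‖z‖ ≤ (p : ℝ) ^ (-y) := by
  obtain ⟨z, hzΛ, hz⟩ := h
  have hp1 : (1 : ℝ) ≤ p := by exact_mod_cast hp.out.one_lt.le
  exact ⟨z, hzΛ, hz.trans (Real.rpow_le_rpow_of_exponent_le hp1 (by linarith))⟩

/-- **Every `e`, integer slot**: with `ρ := ⌊e/(p−1)⌋` (as an integer), some `z ∉ log_p(𝒪_K^×)` has
`‖z‖ ≤ p^{−((ρ : ℝ) − 1)/e}` — the shape of the inner-radius binder of abc-iut-W-row-1's one-sided licence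
wrapper, for EVERY odd `p` and EVERY `K`. [cite: NeukirchANT1999, Ch. II Prop. (5.5)–(5.7)] -/
theorem exists_not_mem_logUnits_norm_le_rpow_div_intSlot (hp2 : p ≠ 2) :
    ∃ z : K, z ∉ logUnits K ∧
      ‖z‖ ≤ (p : ℝ) ^ (-(((((absRamificationIdx p K / (p - 1) : ℕ) : ℤ) : ℝ) - 1) /
        (absRamificationIdx p K : ℝ))) := by
  obtain ⟨z, hzΛ, hz⟩ := exists_not_mem_logUnits_norm_le_rpow_div_pred p hϖ hp2
  refine exists_not_mem_logUnits_norm_le_rpow_of_le p ?_ ⟨z, hzΛ, hz⟩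
  have he : (0 : ℝ) < (absRamificationIdx p K : ℝ) := by exact_mod_cast absRamificationIdx_pos p K
  rw [div_le_div_iff_of_pos_right he, Int.cast_natCast]
  rcases Nat.eq_zero_or_pos (absRamificationIdx p K / (p - 1)) with h0 | h0
  · rw [h0]; norm_num
  · rw [Nat.cast_sub (by omega), Nat.cast_one]

end IntSlot

section IntSlotLevel

variable (p : ℕ) [hp : Fact p.Prime]
variable {K : Type*} [NontriviallyNormedField K] [instK : NormedAlgebra ℚ_[p] K] [IsUltrametricDist K]
  [ProperSpace K]
variable {ϖ : Kˣ} (hϖ : IsUniformizer ϖ) {A : ℕ} (hA : absRamificationIdx p K = A * (p - 1))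
include hϖ hA

/-- **At a tie `e = A·(p−1)`, integer slot**: with `ρ := A = e/(p−1)`, some `z ∉ log_p(𝒪_K^×)` has
`‖z‖ ≤ p^{−((A : ℝ) − 1)/e}` — i.e. the inner-radius binder of the one-sided licence wrapper may be fed
`ρin := e/(p−1)` at every wild tie place (`ζ_p ∈ K` and `p ∣ A` included), for EVERY `K`.
[cite: NeukirchANT1999, Ch. II Prop. (5.5)–(5.7)] -/
theorem exists_not_mem_logUnits_norm_le_rpow_level_intSlot (hp2 : p ≠ 2) :
    ∃ z : K, z ∉ logUnits K ∧
      ‖z‖ ≤ (p : ℝ) ^ (-((((A : ℤ) : ℝ) - 1) / (absRamificationIdx p K : ℝ))) := by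
  obtain ⟨z, hzΛ, hz⟩ := exists_not_mem_logUnits_norm_le_rpow_level_pred p hϖ hA hp2
  refine ⟨z, hzΛ, ?_⟩
  have hA1 := one_le_level p hA
  rwa [Nat.cast_sub hA1, Nat.cast_one, ← Int.cast_natCast (R := ℝ) A] at hz

end IntSlotLevel

end LogEnvelope

end Literature.IUT.LogVolume

end
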